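import Summits.BirchSwinnertonDyer.BirchSwinnertonDyer.Theorems.PrintCf2DisegniPairTwoShaAnBookkeepingOdd
import Summits.BirchSwinnertonDyer.BirchSwinnertonDyer.Theorems.PrintCf2DisegniPairTwoPeriodInput
import HarnessLib

/-!
# Road (C) `disegni-pair-two` on crux stmt-BirchSwinnertonDyer-20368 — the DEFECT KEY of each class MODULO the
# (Δ1) descent law, with the archimedean side DISCHARGED down to the newform period ratio of `V` and Pal's `u(C)`

Cell `bsd-print-cf2`, width seat `bsd-line-cf2-p1-w8` g23; composition of `PrintCf2DisegniPairTwoShaAnBookkeeping[Odd].lean`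
(`shaAn_valuation_chi8/chi4/chi8'`) with `PrintCf2DisegniPairTwoPeriodInput.lean` (`exists_periodInput_*`).
`--supports stmt-BirchSwinnertonDyer-20368` (helper). THEOREMS ONLY (no `def`, no named fact, no `sorry`); conditional
on every displayed hypothesis (Gross–Zagier I.(7.3) as the named-fact hypothesis `GrossZagier1986_thm_I_7_3`, Disegni's
conjoined clauses `ChiLineGrossZagierClauses` = the road's PRINT stub). BSD is not proved by any of this; no summit
statement is claimed; 20368 is not closed here.

## What is proved

* §1 `padicValRat_two_mul_units_div` — `v_p(2s/(a·b)) = v_p(2) − v_p(a) − v_p(b)` for a sign `s`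
  (and `v_p(|a|) = v_p(a)`, tree `TwistComparison.padicValRat_abs`, re-derived inline).
* §2 ★★★ `defectKey_chi8_modulo_descent` (`d* = 2`): frame of `shaAn_valuation_chi8` with the period input REPLACED
  by the plus period ratio `ϖ·Ω(V) = Ω⁺_f` (`ϖ ∈ ℚ^×`). Conclusion: `L₂′(f,−2) ≠ 0` and `shaAn W = q ∈ ℚ^×` with
  `v₂(q) + 1 + v₂(Tam W) + v₂(h₂) = v₂(L₂′(f,−2)) + 2 + 2·v₂(#W(ℚ)_tors) + v₂(u(C)) + v₂(ϖ)`.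
* §3 ★★★ `defectKey_chi4_modulo_descent` (`d* = −1`), ★★★ `defectKey_chi8'_modulo_descent` (`d* = −2`): the same
  with the minus period ratio `μ·Ω⁻(V) = Ω⁻_f` and the real-component count `c_∞(V)`:
  `v₂(q) + 1 + v₂(c_∞(V)) + v₂(Tam W) + v₂(h₂) = v₂(D) + 2 + 2·v₂(#W(ℚ)_tors) + v₂(u(C)) + v₂(μ)`.

So, for each class, the defect key `v₂(shaAn W) = v₂(#Ш[2^∞]) + e(class)` follows from (i) the (Δ1) law
`v₂(D) − v₂(h₂) = v₂(#Ш(W)[2^∞]) + v₂(Tam W) − 2v₂(#tors) + e_D` (descent; research stub) and (ii) the class data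
`v₂(u(C))` (Pal's `ũ` at `2`), `v₂(ϖ)`/`v₂(μ)` (Manin constant / lattice index of `V`'s parametrisation), `c_∞(V)`.

References: D. Disegni, Compos. Math. 153 (2017) Thm. B [Disegni2017]; B. Gross, D. Zagier, Invent. Math. 84 (1986)
Thm. I.(7.3) [GrossZagier1986]; V. Pal, Proc. AMS 140 (2012) Thm. 3.2 [Pal2012]; R. L. Miller, LMS J. Comput. Math.
14 (2011) §1 [Miller2011LMS]; B. Perrin-Riou, Invent. Math. 89 (1987) §1 [PerrinRiou1987].
-/

set_option autoImplicit false
set_option linter.dupNamespace false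

noncomputable section

open scoped Classical MatrixGroups ModularForm NumberField

open CongruenceSubgroup NumberField IsDedekindDomain WeierstrassCurve WeierstrassCurve.Affine.Point
  Literature.NumberTheory.EllipticCurves Literature.NumberTheory.EllipticCurves.ModularForms
  Literature.NumberTheory.EllipticCurves.Disegni2017 Literature.NumberTheory.GaloisRepresentations
  Summit.BirchSwinnertonDyer.Rank1Residual.AdditivePotMult

namespace Summit.BirchSwinnertonDyer.BirchSwinnertonDyer.Theorems.PrintCf2.DisegniPairTwo

/-! ### §1 Valuation of the explicit period factor -/

section Val

variable {p : ℕ}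

/-- `v_p(2s/(a·b)) = v_p(2) − v_p(a) − v_p(b)` for a sign `s` and `a, b ≠ 0`. [folklore] -/
theorem padicValRat_two_mul_units_div [Fact p.Prime] (s : ℤˣ) {a b : ℚ} (ha : a ≠ 0) (hb : b ≠ 0) :
    padicValRat p ((s : ℤ) * 2 / (a * b)) = padicValRat p 2 - padicValRat p a - padicValRat p b := by
  have hs : ((s : ℤ) : ℚ) ≠ 0 := by exact_mod_cast s.ne_zero
  have hvs : padicValRat p ((s : ℤ) : ℚ) = 0 := by
    rcases Int.units_eq_one_or s with rfl | rfl
    · simp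
    · simp [padicValRat.neg]
  rw [padicValRat.div (mul_ne_zero hs two_ne_zero) (mul_ne_zero ha hb), padicValRat.mul hs two_ne_zero,
    padicValRat.mul ha hb, hvs]
  ring

end Val

variable (ι : PadicAlgCl 2 ≃+* ℂ) (K : Type) [Field K] [NumberField K] [IsGalois ℚ K]

/-! ### §2 `d* = 2` -/

/-- ★★★ **The defect key of the `χ₈∘N`-class MODULO the (Δ1) descent law, archimedean side discharged to
`V`'s newform period ratio and Pal's `u(C)`** (module docstring). `d* = 2`: `v₂(q) + 1 + v₂(Tam) + v₂(h₂) = v₂(L₂′(f,−2)) + 2 + 2v₂(#tors) + v₂(u(C)) + v₂(ϖ)`.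
[cite: Disegni2017, Theorem B (arXiv v3 PDF p. 8)] [cite: GrossZagier1986, Thm. I.(7.3)] [cite: Pal2012, Thm. 3.2]
[cite: Miller2011LMS, §1] [cite: PerrinRiou1987, §1] -/
theorem defectKey_chi8_modulo_descent (hGZ73 : GrossZagier1986_thm_I_7_3) (h2 : Module.finrank ℚ K = 2)
    (hsplit : ((Ideal.span {(2 : ℤ)}).primesOver (𝓞 K)).ncard = 2)
    (𝔭 𝔭' : HeightOneSpectrum (𝓞 K)) (h𝔭 : ((2 : ℕ) : 𝓞 K) ∈ 𝔭.asIdeal)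
    (h𝔭' : ((2 : ℕ) : 𝓞 K) ∈ 𝔭'.asIdeal)
    (κ : DirichletCharacter ℂ (NumberField.discr K).natAbs)
    (hκ : ∀ ℓ : ℕ, ℓ.Prime → ℓ ≠ 2 → κ ℓ = (jacobiSym (NumberField.discr K) ℓ : ℂ))
    (hκ2 : κ 2 = if NumberField.discr K % 8 = 1 then 1 else if NumberField.discr K % 8 = 5 then -1 else 0)
    (hd : Nat.Coprime 2 (NumberField.discr K).natAbs)
    -- the good pair
    (V V' : WeierstrassCurve ℚ) [V.IsElliptic] [V.IsGloballyMinimal] [V'.IsElliptic] [V'.IsGloballyMinimal]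
    (hordV : IsOrdinaryAt V 2) (hordV' : IsOrdinaryAt V' 2) (hap : V'.frobeniusTrace 2 = V.frobeniusTrace 2)
    {N N' : ℕ} [NeZero N] [NeZero N'] (hN : ¬ 2 ∣ N) {f : CuspForm (Gamma0 N) 2}
    {f' : CuspForm (Gamma0 N') 2} (hfV : IsNewformOf V f) (hfV' : IsNewformOf V' f')
    (hV' : ∀ n : ℕ, cuspCoeff f' n = κ (n : ZMod _) * cuspCoeff f n)
    (h0 : HasSum (fun k : ℕ ↦ PowerSeries.coeff k (padicLFunction f (unitRoot V 2 : ℚ_[2])) *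
      (-2 : ℚ_[2]) ^ k) 0)
    -- the member (analytic rank one, rank one) and its companion
    (hmod : hasEntireLFunction_rat) {M M' : ℕ} [NeZero M] [NeZero M']
    {g : CuspForm (Gamma0 M) 2} {g' : CuspForm (Gamma0 M') 2}
    (W W' : WeierstrassCurve ℚ) [W.IsElliptic] [W'.IsElliptic]
    (hg : IsNewformOf W g) (hg' : IsNewformOf W' g')
    (hgε : ∀ m : ℕ, cuspCoeff g m = (ZMod.χ₈.ringHomComp (Int.castRingHom ℂ)) m * cuspCoeff f m)
    (hg'ε : ∀ m : ℕ, cuspCoeff g' m = (ZMod.χ₈.ringHomComp (Int.castRingHom ℂ)) m * cuspCoeff f' m)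
    (hr : W.analyticRank = 1) (hrk : W.mordellWeilRank = 1) (hL' : W'.entireLFunction 1 ≠ 0)
    -- the tower frame and the sign character
    {H : Type} [Field H] [NumberField H] [Algebra K H] (hKH : Module.finrank K H = 2) {t : H}
    (htK : t ∉ Set.range (algebraMap K H)) (ht2 : t ^ 2 = algebraMap ℚ H 2)
    (G : Subgroup (H ≃ₐ[ℚ] H)) (χ : G →* ℂˣ) (s : G → ℤ) (hs : ∀ σ, ((χ σ : ℂˣ) : ℂ) = (s σ : ℂ))
    (τ : H ≃ₐ[ℚ] H) (hτG : τ ∈ G) (hsτ : s ⟨τ, hτG⟩ = -1)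
    (hτK : ∀ a : K, τ (algebraMap K H a) = algebraMap K H a) (hτt : τ t = -t)
    {u : K} {e : ℚ} (hu : u ∉ Set.range (algebraMap ℚ K)) (hue : u ^ 2 = algebraMap ℚ K e)
    (c : K ≃ₐ[ℚ] K) (hcu : c u = -u)
    -- the member's explicit model `V^{(2)} = C • W` and its Mordell–Weil generator
    [(V.quadraticTwist 2).IsElliptic] {C : VariableChange ℚ} (hC : C • W = V.quadraticTwist 2)
    {P : (V.quadraticTwist 2).toAffine.Point}
    (hgen : ∀ R : (V.quadraticTwist 2).toAffine.Point,
      ∃ (k : ℤ) (T : (V.quadraticTwist 2).toAffine.Point), IsOfFinAddOrder T ∧ R = k • P + T)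
    (htors : ∀ Q : ((V.quadraticTwist 2).quadraticTwist e).toAffine.Point, IsOfFinAddOrder Q)
    -- Disegni's datum: invariance, PIN, and the conjoined clauses (PRINT stub of the road)
    (DH : PAdicHeightDataK V 2 H)
    (hDH : ∀ (σ : G) (a b : (V.baseChange H).toAffine.Point),
      DH.pairing (pointGalHom V H σ.1 a) (pointGalHom V H σ.1 b) = DH.pairing a b)
    {h₂ : ℚ_[2]}
    (hpin : DH.pairing
      (twistPointEquivOver V (not_mem_range_rat_of_not_mem_range htK) ht2
        (QuadraticDescent.incl H (V.quadraticTwist 2) P))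
      (twistPointEquivOver V (not_mem_range_rat_of_not_mem_range htK) ht2
        (QuadraticDescent.incl H (V.quadraticTwist 2) P)) = h₂)
    (hGZ : ChiLineGrossZagierClauses ι K V H f (ι (((unitRoot V 2 : ℚ_[2]) : PadicAlgCl 2)))
      (baseChangeDirichlet K (ZMod.χ₈.ringHomComp (Int.castRingHom ℂ))) 𝔭 𝔭' G χ DH)
    -- the plus period ratio of `V` (Manin constant / lattice index; from a ModularParametrizationData)
    {ϖ : ℚ} (hϖ0 : ϖ ≠ 0) (hϖ : (ϖ : ℝ) * V.realPeriodRat = plusPeriod f)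
    -- Bertrand: the 2-adic height of the member's generator is non-zero
    (hh₂ : h₂ ≠ 0) :
    (∑' k : ℕ, PowerSeries.coeff k (padicLFunction f (unitRoot V 2 : ℚ_[2])) * (k : ℚ_[2]) *
        (-2) ^ (k - 1)) ≠ 0 ∧
    ∃ q : ℚ, shaAn W = (q : ℂ) ∧ q ≠ 0 ∧
      padicValRat 2 q + 1 + (padicValNat 2 W.tamagawaProduct : ℤ) + h₂.valuation =
        ((∑' k : ℕ, PowerSeries.coeff k (padicLFunction f (unitRoot V 2 : ℚ_[2])) * (k : ℚ_[2]) *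
        (-2) ^ (k - 1))).valuation + 2 +
          2 * (padicValNat 2 W.torsionOrder : ℤ) + padicValRat 2 (C.u : ℚ) + padicValRat 2 ϖ := by
  obtain ⟨sgn, hl⟩ := exists_periodInput_chi8 V W hC f hϖ0 hϖ
  obtain ⟨hD, q, hq, hq0, hv⟩ := shaAn_valuation_chi8 ι K hGZ73 h2 hsplit 𝔭 𝔭' h𝔭 h𝔭' κ hκ hκ2 hd V V' hordV hordV' hap hN hfV
    hfV' hV' h0 hmod W W' hg hg' hgε hg'ε hr hrk hL' hKH htK ht2 G χ s hs τ hτG hsτ hτK hτt hu hue c hcu hC hgen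
    htors DH hDH hpin hGZ hl hh₂
  refine ⟨hD, q, hq, hq0, ?_⟩
  have hu0 : (|(C.u : ℚ)| : ℚ) ≠ 0 := abs_ne_zero.mpr C.u.ne_zero
  have h2v : padicValRat 2 (2 : ℚ) = 1 := by
    rw [show (2 : ℚ) = ((2 : ℕ) : ℚ) by norm_num, padicValRat.of_nat, padicValNat_self]; rfl
  have habsv : padicValRat 2 |(C.u : ℚ)| = padicValRat 2 (C.u : ℚ) := by
    rcases abs_choice (C.u : ℚ) with h | h
    · rw [h]
    · rw [h, padicValRat.neg]
  rw [padicValRat_two_mul_units_div (p := 2) sgn hu0 hϖ0, habsv, h2v] at hv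
  linear_combination hv
/-! ### §3 `d* = −1, −2` -/

/-- ★★★ **The defect key of the `χ₋₄∘N`-class MODULO the (Δ1) descent law, archimedean side discharged to
`V`'s newform period ratio and Pal's `u(C)`** (module docstring). `d* = −1`: `v₂(q) + 1 + v₂(c_∞(V)) + v₂(Tam) + v₂(h₂) = v₂([T¹]L₂⁻(f,ω,T)) + 2 + 2v₂(#tors) + v₂(u(C)) + v₂(μ)`.
[cite: Disegni2017, Theorem B (arXiv v3 PDF p. 8)] [cite: GrossZagier1986, Thm. I.(7.3)] [cite: Pal2012, Thm. 3.2]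
[cite: Miller2011LMS, §1] [cite: PerrinRiou1987, §1] -/
theorem defectKey_chi4_modulo_descent (hGZ73 : GrossZagier1986_thm_I_7_3) (h2 : Module.finrank ℚ K = 2)
    (hsplit : ((Ideal.span {(2 : ℤ)}).primesOver (𝓞 K)).ncard = 2)
    (𝔭 𝔭' : HeightOneSpectrum (𝓞 K)) (h𝔭 : ((2 : ℕ) : 𝓞 K) ∈ 𝔭.asIdeal)
    (h𝔭' : ((2 : ℕ) : 𝓞 K) ∈ 𝔭'.asIdeal)
    (κ : DirichletCharacter ℂ (NumberField.discr K).natAbs)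
    (hκ : ∀ ℓ : ℕ, ℓ.Prime → ℓ ≠ 2 → κ ℓ = (jacobiSym (NumberField.discr K) ℓ : ℂ))
    (hκ2 : κ 2 = if NumberField.discr K % 8 = 1 then 1 else if NumberField.discr K % 8 = 5 then -1 else 0)
    (hd : Nat.Coprime 2 (NumberField.discr K).natAbs)
    (V V' : WeierstrassCurve ℚ) [V.IsElliptic] [V.IsGloballyMinimal] [V'.IsElliptic] [V'.IsGloballyMinimal]
    (hordV : IsOrdinaryAt V 2) (hordV' : IsOrdinaryAt V' 2) (hap : V'.frobeniusTrace 2 = V.frobeniusTrace 2)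
    {N N' : ℕ} [NeZero N] [NeZero N'] {f : CuspForm (Gamma0 N) 2}
    {f' : CuspForm (Gamma0 N') 2} (hfV : IsNewformOf V f) (hfV' : IsNewformOf V' f')
    (hV' : ∀ n : ℕ, cuspCoeff f' n = κ (n : ZMod _) * cuspCoeff f n)
    (h0 : PowerSeries.constantCoeff (padicLFunctionMinusBranch f (unitRoot V 2 : ℚ_[2]) 1) = 0)
    (hmod : hasEntireLFunction_rat) {M M' : ℕ} [NeZero M] [NeZero M']
    {g : CuspForm (Gamma0 M) 2} {g' : CuspForm (Gamma0 M') 2}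
    (W W' : WeierstrassCurve ℚ) [W.IsElliptic] [W'.IsElliptic]
    (hg : IsNewformOf W g) (hg' : IsNewformOf W' g')
    (hgε : ∀ m : ℕ, cuspCoeff g m = (ZMod.χ₄.ringHomComp (Int.castRingHom ℂ)) m * cuspCoeff f m)
    (hg'ε : ∀ m : ℕ, cuspCoeff g' m = (ZMod.χ₄.ringHomComp (Int.castRingHom ℂ)) m * cuspCoeff f' m)
    (hr : W.analyticRank = 1) (hrk : W.mordellWeilRank = 1) (hL' : W'.entireLFunction 1 ≠ 0)
    {H : Type} [Field H] [NumberField H] [Algebra K H] (hKH : Module.finrank K H = 2) {t : H}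
    (htK : t ∉ Set.range (algebraMap K H)) (ht2 : t ^ 2 = algebraMap ℚ H (-1))
    (G : Subgroup (H ≃ₐ[ℚ] H)) (χ : G →* ℂˣ) (s : G → ℤ) (hs : ∀ σ, ((χ σ : ℂˣ) : ℂ) = (s σ : ℂ))
    (τ : H ≃ₐ[ℚ] H) (hτG : τ ∈ G) (hsτ : s ⟨τ, hτG⟩ = -1)
    (hτK : ∀ a : K, τ (algebraMap K H a) = algebraMap K H a) (hτt : τ t = -t)
    {u : K} {e : ℚ} (hu : u ∉ Set.range (algebraMap ℚ K)) (hue : u ^ 2 = algebraMap ℚ K e)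
    (c : K ≃ₐ[ℚ] K) (hcu : c u = -u)
    [(V.quadraticTwist (-1)).IsElliptic] {C : VariableChange ℚ} (hC : C • W = V.quadraticTwist (-1))
    {P : (V.quadraticTwist (-1)).toAffine.Point}
    (hgen : ∀ R : (V.quadraticTwist (-1)).toAffine.Point,
      ∃ (k : ℤ) (T : (V.quadraticTwist (-1)).toAffine.Point), IsOfFinAddOrder T ∧ R = k • P + T)
    (htors : ∀ Q : ((V.quadraticTwist (-1)).quadraticTwist e).toAffine.Point, IsOfFinAddOrder Q)
    (DH : PAdicHeightDataK V 2 H)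
    (hDH : ∀ (σ : G) (a b : (V.baseChange H).toAffine.Point),
      DH.pairing (pointGalHom V H σ.1 a) (pointGalHom V H σ.1 b) = DH.pairing a b)
    {h₂ : ℚ_[2]}
    (hpin : DH.pairing
      (twistPointEquivOver V (not_mem_range_rat_of_not_mem_range htK) ht2
        (QuadraticDescent.incl H (V.quadraticTwist (-1)) P))
      (twistPointEquivOver V (not_mem_range_rat_of_not_mem_range htK) ht2
        (QuadraticDescent.incl H (V.quadraticTwist (-1)) P)) = h₂)
    (hGZ : ChiLineGrossZagierClauses ι K V H f (ι (((unitRoot V 2 : ℚ_[2]) : PadicAlgCl 2)))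
      (baseChangeDirichlet K (ZMod.χ₄.ringHomComp (Int.castRingHom ℂ))) 𝔭 𝔭' G χ DH)
    -- the minus period ratio of `V` (Manin constant / lattice index; from a ModularParametrizationData)
    {μ : ℚ} (hμ0 : μ ≠ 0) (hμ : (μ : ℝ) * V.imaginaryPeriodRat = minusPeriod f)
    -- Bertrand: the 2-adic height of the member's generator is non-zero
    (hh₂ : h₂ ≠ 0) :
    (PowerSeries.coeff 1 (padicLFunctionMinusBranch f (unitRoot V 2 : ℚ_[2]) 1)) ≠ 0 ∧
    ∃ q : ℚ, shaAn W = (q : ℂ) ∧ q ≠ 0 ∧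
      padicValRat 2 q + 1 + (padicValNat 2 (V.baseChange ℝ).numRealComponents : ℤ) + (padicValNat 2 W.tamagawaProduct : ℤ) + h₂.valuation =
        ((PowerSeries.coeff 1 (padicLFunctionMinusBranch f (unitRoot V 2 : ℚ_[2]) 1))).valuation + 2 +
          2 * (padicValNat 2 W.torsionOrder : ℤ) + padicValRat 2 (C.u : ℚ) + padicValRat 2 μ := by
  obtain ⟨sgn, hl⟩ := exists_periodInput_chi4 V W hC f hμ0 hμ
  obtain ⟨hD, q, hq, hq0, hv⟩ := shaAn_valuation_chi4 ι K hGZ73 h2 hsplit 𝔭 𝔭' h𝔭 h𝔭' κ hκ hκ2 hd V V' hordV hordV' hap hfV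
    hfV' hV' h0 hmod W W' hg hg' hgε hg'ε hr hrk hL' hKH htK ht2 G χ s hs τ hτG hsτ hτK hτt hu hue c hcu hC hgen
    htors DH hDH hpin hGZ hl hh₂
  refine ⟨hD, q, hq, hq0, ?_⟩
  have hu0 : (|(C.u : ℚ)| : ℚ) ≠ 0 := abs_ne_zero.mpr C.u.ne_zero
  have h2v : padicValRat 2 (2 : ℚ) = 1 := by
    rw [show (2 : ℚ) = ((2 : ℕ) : ℚ) by norm_num, padicValRat.of_nat, padicValNat_self]; rfl
  have habsv : padicValRat 2 |(C.u : ℚ)| = padicValRat 2 (C.u : ℚ) := by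
    rcases abs_choice (C.u : ℚ) with h | h
    · rw [h]
    · rw [h, padicValRat.neg]
  have hn0 : (((V.baseChange ℝ).numRealComponents : ℕ) : ℚ) ≠ 0 := by
    have h12 : (V.baseChange ℝ).numRealComponents = 1 ∨ (V.baseChange ℝ).numRealComponents = 2 := by
      unfold WeierstrassCurve.numRealComponents; split_ifs <;> simp
    rcases h12 with h | h <;> simp [h]
  rw [show ((sgn : ℤ) : ℚ) * 2 * ((V.baseChange ℝ).numRealComponents : ℚ) / (|(C.u : ℚ)| * μ) =
      (sgn : ℤ) * 2 / (|(C.u : ℚ)| * μ) * ((V.baseChange ℝ).numRealComponents : ℚ) by ring,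
    padicValRat.mul (div_ne_zero (mul_ne_zero (by exact_mod_cast sgn.ne_zero) two_ne_zero) (mul_ne_zero hu0 hμ0))
      hn0, padicValRat_two_mul_units_div (p := 2) sgn hu0 hμ0, habsv, h2v, padicValRat.of_nat] at hv
  linear_combination hv
/-- ★★★ **The defect key of the `χ₋₈∘N`-class MODULO the (Δ1) descent law, archimedean side discharged to
`V`'s newform period ratio and Pal's `u(C)`** (module docstring). `d* = −2`: `v₂(q) + 1 + v₂(c_∞(V)) + v₂(Tam) + v₂(h₂) = v₂(L₂⁻′(f,ω,−2)) + 2 + 2v₂(#tors) + v₂(u(C)) + v₂(μ)`.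
[cite: Disegni2017, Theorem B (arXiv v3 PDF p. 8)] [cite: GrossZagier1986, Thm. I.(7.3)] [cite: Pal2012, Thm. 3.2]
[cite: Miller2011LMS, §1] [cite: PerrinRiou1987, §1] -/
theorem defectKey_chi8'_modulo_descent (hGZ73 : GrossZagier1986_thm_I_7_3) (h2 : Module.finrank ℚ K = 2)
    (hsplit : ((Ideal.span {(2 : ℤ)}).primesOver (𝓞 K)).ncard = 2)
    (𝔭 𝔭' : HeightOneSpectrum (𝓞 K)) (h𝔭 : ((2 : ℕ) : 𝓞 K) ∈ 𝔭.asIdeal)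
    (h𝔭' : ((2 : ℕ) : 𝓞 K) ∈ 𝔭'.asIdeal)
    (κ : DirichletCharacter ℂ (NumberField.discr K).natAbs)
    (hκ : ∀ ℓ : ℕ, ℓ.Prime → ℓ ≠ 2 → κ ℓ = (jacobiSym (NumberField.discr K) ℓ : ℂ))
    (hκ2 : κ 2 = if NumberField.discr K % 8 = 1 then 1 else if NumberField.discr K % 8 = 5 then -1 else 0)
    (hd : Nat.Coprime 2 (NumberField.discr K).natAbs)
    (V V' : WeierstrassCurve ℚ) [V.IsElliptic] [V.IsGloballyMinimal] [V'.IsElliptic] [V'.IsGloballyMinimal]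
    (hordV : IsOrdinaryAt V 2) (hordV' : IsOrdinaryAt V' 2) (hap : V'.frobeniusTrace 2 = V.frobeniusTrace 2)
    {N N' : ℕ} [NeZero N] [NeZero N'] {f : CuspForm (Gamma0 N) 2}
    {f' : CuspForm (Gamma0 N') 2} (hfV : IsNewformOf V f) (hfV' : IsNewformOf V' f')
    (hV' : ∀ n : ℕ, cuspCoeff f' n = κ (n : ZMod _) * cuspCoeff f n)
    (h0 : HasSum (fun k : ℕ ↦ PowerSeries.coeff k (padicLFunctionMinusBranch f (unitRoot V 2 : ℚ_[2]) 1) *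
      (-2 : ℚ_[2]) ^ k) 0)
    (hmod : hasEntireLFunction_rat) {M M' : ℕ} [NeZero M] [NeZero M']
    {g : CuspForm (Gamma0 M) 2} {g' : CuspForm (Gamma0 M') 2}
    (W W' : WeierstrassCurve ℚ) [W.IsElliptic] [W'.IsElliptic]
    (hg : IsNewformOf W g) (hg' : IsNewformOf W' g')
    (hgε : ∀ m : ℕ, cuspCoeff g m = (ZMod.χ₈'.ringHomComp (Int.castRingHom ℂ)) m * cuspCoeff f m)
    (hg'ε : ∀ m : ℕ, cuspCoeff g' m = (ZMod.χ₈'.ringHomComp (Int.castRingHom ℂ)) m * cuspCoeff f' m)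
    (hr : W.analyticRank = 1) (hrk : W.mordellWeilRank = 1) (hL' : W'.entireLFunction 1 ≠ 0)
    {H : Type} [Field H] [NumberField H] [Algebra K H] (hKH : Module.finrank K H = 2) {t : H}
    (htK : t ∉ Set.range (algebraMap K H)) (ht2 : t ^ 2 = algebraMap ℚ H (-2))
    (G : Subgroup (H ≃ₐ[ℚ] H)) (χ : G →* ℂˣ) (s : G → ℤ) (hs : ∀ σ, ((χ σ : ℂˣ) : ℂ) = (s σ : ℂ))
    (τ : H ≃ₐ[ℚ] H) (hτG : τ ∈ G) (hsτ : s ⟨τ, hτG⟩ = -1)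
    (hτK : ∀ a : K, τ (algebraMap K H a) = algebraMap K H a) (hτt : τ t = -t)
    {u : K} {e : ℚ} (hu : u ∉ Set.range (algebraMap ℚ K)) (hue : u ^ 2 = algebraMap ℚ K e)
    (c : K ≃ₐ[ℚ] K) (hcu : c u = -u)
    [(V.quadraticTwist (-2)).IsElliptic] {C : VariableChange ℚ} (hC : C • W = V.quadraticTwist (-2))
    {P : (V.quadraticTwist (-2)).toAffine.Point}
    (hgen : ∀ R : (V.quadraticTwist (-2)).toAffine.Point,
      ∃ (k : ℤ) (T : (V.quadraticTwist (-2)).toAffine.Point), IsOfFinAddOrder T ∧ R = k • P + T)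
    (htors : ∀ Q : ((V.quadraticTwist (-2)).quadraticTwist e).toAffine.Point, IsOfFinAddOrder Q)
    (DH : PAdicHeightDataK V 2 H)
    (hDH : ∀ (σ : G) (a b : (V.baseChange H).toAffine.Point),
      DH.pairing (pointGalHom V H σ.1 a) (pointGalHom V H σ.1 b) = DH.pairing a b)
    {h₂ : ℚ_[2]}
    (hpin : DH.pairing
      (twistPointEquivOver V (not_mem_range_rat_of_not_mem_range htK) ht2
        (QuadraticDescent.incl H (V.quadraticTwist (-2)) P))
      (twistPointEquivOver V (not_mem_range_rat_of_not_mem_range htK) ht2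
        (QuadraticDescent.incl H (V.quadraticTwist (-2)) P)) = h₂)
    (hGZ : ChiLineGrossZagierClauses ι K V H f (ι (((unitRoot V 2 : ℚ_[2]) : PadicAlgCl 2)))
      (baseChangeDirichlet K (ZMod.χ₈'.ringHomComp (Int.castRingHom ℂ))) 𝔭 𝔭' G χ DH)
    -- the minus period ratio of `V` (Manin constant / lattice index; from a ModularParametrizationData)
    {μ : ℚ} (hμ0 : μ ≠ 0) (hμ : (μ : ℝ) * V.imaginaryPeriodRat = minusPeriod f)
    -- Bertrand: the 2-adic height of the member's generator is non-zero
    (hh₂ : h₂ ≠ 0) :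
    (∑' k : ℕ, PowerSeries.coeff k
        (padicLFunctionMinusBranch f (unitRoot V 2 : ℚ_[2]) 1) * (k : ℚ_[2]) * (-2) ^ (k - 1)) ≠ 0 ∧
    ∃ q : ℚ, shaAn W = (q : ℂ) ∧ q ≠ 0 ∧
      padicValRat 2 q + 1 + (padicValNat 2 (V.baseChange ℝ).numRealComponents : ℤ) + (padicValNat 2 W.tamagawaProduct : ℤ) + h₂.valuation =
        ((∑' k : ℕ, PowerSeries.coeff k
        (padicLFunctionMinusBranch f (unitRoot V 2 : ℚ_[2]) 1) * (k : ℚ_[2]) * (-2) ^ (k - 1))).valuation + 2 +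
          2 * (padicValNat 2 W.torsionOrder : ℤ) + padicValRat 2 (C.u : ℚ) + padicValRat 2 μ := by
  obtain ⟨sgn, hl⟩ := exists_periodInput_chi8' V W hC f hμ0 hμ
  obtain ⟨hD, q, hq, hq0, hv⟩ := shaAn_valuation_chi8' ι K hGZ73 h2 hsplit 𝔭 𝔭' h𝔭 h𝔭' κ hκ hκ2 hd V V' hordV hordV' hap hfV
    hfV' hV' h0 hmod W W' hg hg' hgε hg'ε hr hrk hL' hKH htK ht2 G χ s hs τ hτG hsτ hτK hτt hu hue c hcu hC hgen
    htors DH hDH hpin hGZ hl hh₂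
  refine ⟨hD, q, hq, hq0, ?_⟩
  have hu0 : (|(C.u : ℚ)| : ℚ) ≠ 0 := abs_ne_zero.mpr C.u.ne_zero
  have h2v : padicValRat 2 (2 : ℚ) = 1 := by
    rw [show (2 : ℚ) = ((2 : ℕ) : ℚ) by norm_num, padicValRat.of_nat, padicValNat_self]; rfl
  have habsv : padicValRat 2 |(C.u : ℚ)| = padicValRat 2 (C.u : ℚ) := by
    rcases abs_choice (C.u : ℚ) with h | h
    · rw [h]
    · rw [h, padicValRat.neg]
  have hn0 : (((V.baseChange ℝ).numRealComponents : ℕ) : ℚ) ≠ 0 := by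
    have h12 : (V.baseChange ℝ).numRealComponents = 1 ∨ (V.baseChange ℝ).numRealComponents = 2 := by
      unfold WeierstrassCurve.numRealComponents; split_ifs <;> simp
    rcases h12 with h | h <;> simp [h]
  rw [show ((sgn : ℤ) : ℚ) * 2 * ((V.baseChange ℝ).numRealComponents : ℚ) / (|(C.u : ℚ)| * μ) =
      (sgn : ℤ) * 2 / (|(C.u : ℚ)| * μ) * ((V.baseChange ℝ).numRealComponents : ℚ) by ring,
    padicValRat.mul (div_ne_zero (mul_ne_zero (by exact_mod_cast sgn.ne_zero) two_ne_zero) (mul_ne_zero hu0 hμ0))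
      hn0, padicValRat_two_mul_units_div (p := 2) sgn hu0 hμ0, habsv, h2v, padicValRat.of_nat] at hv
  linear_combination hv
end Summit.BirchSwinnertonDyer.BirchSwinnertonDyer.Theorems.PrintCf2.DisegniPairTwo

end
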